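import Literature.Analysis.FluidPDE.CorrectorFourierDataDefs
import Literature.Analysis.FluidPDE.CorrectorFourierTimeRegularity
import Literature.Analysis.FluidPDE.CorrectorFourierSymmetry
import Literature.Analysis.FluidPDE.TorusHeatForcedIcc
import HarnessLib

/-!
# Fourier-side data of a smooth background on `[0, θ] × 𝕋^d`: families, continuity, decay, symmetries

Analysis/FluidPDE proof file, seventh of the files discharging
`Literature.Analysis.FluidPDE.Torus.CheskidovLuo2022LocalExistence` (objects in
`CorrectorFourierDefs`, `CorrectorFourierDataDefs`). For a background velocity `u` (divergence
free) and stress `R` jointly smooth on `[0, θ] × 𝕋^d`, the Fourier-side data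
`U = driftCoeff θ u`, `RH = stressCoeff θ R` of the Picard iteration satisfy:

* the drift and stress families `driftFam`, `stressFam` are coefficient families of every order
  on `[0, θ]` (`ScalarFourier.isCoeffFamily_coeffFamily`), with the clamped coefficients as
  zeroth members on `[0, θ]`;
* `dataHyp` — the hypotheses `DataHyp θ U RH` of `CorrectorFourierPicard` (continuity in time,
  every decay uniformly in time) for `0 < θ ≤ 1`;
* `driftCoeff_neg_eq_conj`, `stressCoeff_neg_eq_conj` — conjugation symmetry (the data are
  real; Grafakos 2014, Prop. 3.2.5);
* `sum_intCast_mul_driftCoeff` — Fourier-side divergence freedom of the drift,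
  `∑ⱼ mⱼ Uⱼ(t, m) = 0` (`𝓕(div u) = ∑ⱼ 2πimⱼ ûⱼ = 0`);
* `hasDecay_driftCoeff_of_forall`, `hasDecay_stressCoeff_of_forall` — decay constants valid at
  all times of `[0, θ]` transfer to the clamped coefficients at all times (used with the
  *global* constants of the background on `[0, T]`, which makes the interval threshold uniform
  in the position of the interval).

## References

* A. Cheskidov, X. Luo, arXiv:2009.06596, §3.1 (3.2). [`CheskidovLuo2022`]
* L. Grafakos, *Classical Fourier Analysis*, 3rd ed. (2014), Prop. 3.2.5, Prop. 3.2.6 (8). [`Grafakos2014`]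
-/

noncomputable section

open MeasureTheory Real Set Filter Topology UnitAddTorus

namespace Literature.Analysis.FluidPDE

namespace CorrectorFourier

open scoped ComplexConjugate
open ScalarFourier
open FourierNS (HasDecay clamp)
open Literature.Analysis.FunctionSpaces.Torus (freqNormSq IsSmoothSpaceTimeOn IsSmooth)

variable {d : Type*} [Fintype d] [DecidableEq d]
variable {θ : ℝ} {u : ℝ → UnitAddTorus d → EuclideanSpace ℝ d}
  {R : ℝ → UnitAddTorus d → d → EuclideanSpace ℝ d}

/-! ### Smoothness of the complexified components; families -/

omit [DecidableEq d] in
/-- The complexified components of a jointly smooth vector field are jointly smooth. [folklore] -/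
theorem isSmoothSpaceTimeOn_compC {S : Set ℝ} (hu : IsSmoothSpaceTimeOn S u) (j : d) :
    IsSmoothSpaceTimeOn S (compC u j) :=
  (hu.apply j).ofReal

omit [DecidableEq d] in
/-- The complexified entries of a jointly smooth tensor field are jointly smooth. [folklore] -/
theorem isSmoothSpaceTimeOn_entryC {S : Set ℝ} (hR : IsSmoothSpaceTimeOn S R) (l j : d) :
    IsSmoothSpaceTimeOn S (entryC R l j) :=
  ((hR.clm_comp (ContinuousLinearMap.proj (R := ℝ) (φ := fun _ : d => EuclideanSpace ℝ d) j)).apply l).ofReal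

/-- **The drift families are coefficient families of every order** on `[0, θ]`. [folklore] -/
theorem isCoeffFamily_driftFam (hθ : 0 < θ) (hu : IsSmoothSpaceTimeOn (Icc 0 θ) u) (n : ℕ) (j : d) :
    IsCoeffFamily θ n (driftFam θ u j) :=
  isCoeffFamily_coeffFamily hθ (isSmoothSpaceTimeOn_compC hu j) n

/-- **The stress families are coefficient families of every order** on `[0, θ]`. [folklore] -/
theorem isCoeffFamily_stressFam (hθ : 0 < θ) (hR : IsSmoothSpaceTimeOn (Icc 0 θ) R) (n : ℕ) (l j : d) :
    IsCoeffFamily θ n (stressFam θ R l j) :=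
  isCoeffFamily_coeffFamily hθ (isSmoothSpaceTimeOn_entryC hR l j) n

/-! ### The Picard hypotheses of the data -/

/-- **The Fourier-side data of a smooth background satisfy `DataHyp`** for `0 < θ ≤ 1`:
continuity in time at each frequency (the zeroth members are continuous on `[0, θ]`, composed
with the continuous clamp) and every decay uniformly in time (uniform on the compact `[0, θ]`,
then constant), exactly as in the scalar construction. [folklore] -/
theorem dataHyp (hθ : 0 < θ) (hθ1 : θ ≤ 1) (hu : IsSmoothSpaceTimeOn (Icc 0 θ) u)
    (hR : IsSmoothSpaceTimeOn (Icc 0 θ) R) : DataHyp θ (driftCoeff θ u) (stressCoeff θ R) := by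
  have hUFf : ∀ n j, IsCoeffFamily θ n (driftFam θ u j) := isCoeffFamily_driftFam hθ hu
  have hRFf : ∀ n l j, IsCoeffFamily θ n (stressFam θ R l j) := isCoeffFamily_stressFam hθ hR
  refine ⟨hθ, hθ1, fun j m => ?_, fun K => ?_, fun i j m => ?_, fun K => ?_⟩
  · exact ((hUFf 0 j).cont 0 le_rfl m).comp_continuous (FourierNS.continuous_clamp θ)
      fun t => FourierNS.clamp_mem_Icc hθ.le t
  · have h1 : ∀ j, ∃ C : ℝ, 0 ≤ C ∧ ∀ t ∈ Icc 0 θ, HasDecay K C (driftFam θ u j 0 t) := fun j =>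
      (hUFf 0 j).decay_nonneg le_rfl K
    choose C hC0 hC using h1
    refine ⟨∑ j, C j, fun j t => ((hC j _ (FourierNS.clamp_mem_Icc hθ.le t)).mono ?_)⟩
    exact Finset.single_le_sum (fun i _ => hC0 i) (Finset.mem_univ j)
  · exact ((hRFf 0 i j).cont 0 le_rfl m).comp_continuous (FourierNS.continuous_clamp θ)
      fun t => FourierNS.clamp_mem_Icc hθ.le t
  · have h1 : ∀ q : d × d, ∃ C : ℝ, 0 ≤ C ∧ ∀ t ∈ Icc 0 θ, HasDecay K C (stressFam θ R q.1 q.2 0 t) :=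
      fun q => (hRFf 0 q.1 q.2).decay_nonneg le_rfl K
    choose C hC0 hC using h1
    refine ⟨∑ q, C q, fun i j t => ((hC (i, j) _ (FourierNS.clamp_mem_Icc hθ.le t)).mono ?_)⟩
    exact Finset.single_le_sum (fun q _ => hC0 q) (Finset.mem_univ (i, j))

/-! ### Reality: conjugation symmetry of the data -/

omit [DecidableEq d] in
/-- The drift coefficients of a real background are conjugate symmetric. [folklore] -/
theorem driftCoeff_neg_eq_conj (θ : ℝ) (u : ℝ → UnitAddTorus d → EuclideanSpace ℝ d) (j : d) (t : ℝ)
    (m : d → ℤ) : driftCoeff θ u j t (-m) = conj (driftCoeff θ u j t m) := by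
  rw [driftCoeff_apply, driftCoeff_apply]
  exact FunctionSpaces.Torus.mFourierCoeff_ofReal_comp (fun x => u (clamp θ t) x j) m

omit [DecidableEq d] in
/-- The stress coefficients of a real background are conjugate symmetric. [folklore] -/
theorem stressCoeff_neg_eq_conj (θ : ℝ) (R : ℝ → UnitAddTorus d → d → EuclideanSpace ℝ d) (l j : d)
    (t : ℝ) (m : d → ℤ) : stressCoeff θ R l j t (-m) = conj (stressCoeff θ R l j t m) := by
  rw [stressCoeff_apply, stressCoeff_apply]
  exact FunctionSpaces.Torus.mFourierCoeff_ofReal_comp (fun x => R (clamp θ t) x j l) m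

/-! ### Divergence freedom of the drift on the Fourier side -/

/-- `𝓕(div u) = ∑ⱼ 2πimⱼ 𝓕(uⱼ)`: for a smooth divergence-free real vector field,
`∑ⱼ mⱼ 𝓕((uⱼ : ℂ))(m) = 0`. [folklore] -/
theorem sum_intCast_mul_mFourierCoeff_eq_zero {v : UnitAddTorus d → EuclideanSpace ℝ d}
    (hv : IsSmooth v) (hdiv : FunctionSpaces.Torus.IsDivFree v) (m : d → ℤ) :
    ∑ j, (m j : ℂ) * mFourierCoeff (fun x => ((v x j : ℝ) : ℂ)) m = 0 := by
  -- the complexified divergence vanishes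
  have hC : ∀ j, IsSmooth (fun x => ((v x j : ℝ) : ℂ)) := fun j => (hv.apply j).comp_clm Complex.ofRealCLM
  have hzero : (fun x => ∑ j, FunctionSpaces.Torus.partialDeriv j (fun y => ((v y j : ℝ) : ℂ)) x) =
      fun _ => (0 : ℂ) := by
    funext x
    have h := hdiv x
    rw [FunctionSpaces.Torus.divergence] at h
    have h2 : ∑ j, FunctionSpaces.Torus.partialDeriv j (fun y => ((v y j : ℝ) : ℂ)) x =
        ((∑ j, FunctionSpaces.Torus.partialDeriv j (fun y => v y j) x : ℝ) : ℂ) := by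
      rw [Complex.ofReal_sum]
      refine Finset.sum_congr rfl fun j _ => ?_
      exact Torus.partialDeriv_ofReal (hv.apply j) j x
    rw [h2, h, Complex.ofReal_zero]
  have hcoef := congrArg (fun g => mFourierCoeff g m) hzero
  simp only at hcoef
  rw [FunctionSpaces.Torus.mFourierCoeff_finset_sum _ fun j _ =>
      ((hC j).partialDeriv j).continuous.integrable_unitAddTorus, Torus.mFourierCoeff_zero_fun] at hcoef
  simp_rw [FunctionSpaces.Torus.mFourierCoeff_partialDeriv (hC _)] at hcoef
  -- cancel the factor `2πi`
  have h2pi : (2 * Real.pi * Complex.I : ℂ) ≠ 0 := by simp [Real.pi_ne_zero, Complex.I_ne_zero]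
  have hsum : ∑ j, (2 * Real.pi * Complex.I * (m j : ℂ)) • mFourierCoeff (fun x => ((v x j : ℝ) : ℂ)) m =
      (2 * Real.pi * Complex.I) * ∑ j, (m j : ℂ) * mFourierCoeff (fun x => ((v x j : ℝ) : ℂ)) m := by
    rw [Finset.mul_sum]
    refine Finset.sum_congr rfl fun j _ => ?_
    rw [smul_eq_mul]; ring
  rw [hsum] at hcoef
  exact (mul_eq_zero.1 hcoef).resolve_left h2pi

/-- **Fourier-side divergence freedom of the drift coefficients**: `∑ⱼ mⱼ Uⱼ(t, m) = 0` for all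
`t ∈ ℝ` (the clamped time lies in `[0, θ]`, where `div u = 0`). [folklore] -/
theorem sum_intCast_mul_driftCoeff (hθ : 0 ≤ θ) (hu : IsSmoothSpaceTimeOn (Icc 0 θ) u)
    (hdiv : ∀ t ∈ Icc 0 θ, FunctionSpaces.Torus.IsDivFree (u t)) (t : ℝ) (m : d → ℤ) :
    ∑ j, (m j : ℂ) * driftCoeff θ u j t m = 0 := by
  have hs := FourierNS.clamp_mem_Icc hθ t
  simp only [driftCoeff_apply]
  exact sum_intCast_mul_mFourierCoeff_eq_zero (hu.isSmooth_slice hs) (hdiv _ hs) m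

/-! ### Transfer of decay constants -/

omit [DecidableEq d] in
/-- Decay of the drift coefficients at every time of `[0, θ]` gives decay of the clamped
coefficients at every time. [folklore] -/
theorem hasDecay_driftCoeff_of_forall (hθ : 0 ≤ θ) {K : ℕ} {A : ℝ}
    (hA : ∀ t ∈ Icc 0 θ, ∀ j, HasDecay K A (fun m => mFourierCoeff (compC u j t) m)) (j : d) (t : ℝ) :
    HasDecay K A (driftCoeff θ u j t) :=
  hA _ (FourierNS.clamp_mem_Icc hθ t) j

omit [DecidableEq d] in
/-- Decay of the stress coefficients at every time of `[0, θ]` gives decay of the clamped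
coefficients at every time. [folklore] -/
theorem hasDecay_stressCoeff_of_forall (hθ : 0 ≤ θ) {K : ℕ} {B : ℝ}
    (hB : ∀ t ∈ Icc 0 θ, ∀ l j, HasDecay K B (fun m => mFourierCoeff (entryC R l j t) m)) (l j : d)
    (t : ℝ) : HasDecay K B (stressCoeff θ R l j t) :=
  hB _ (FourierNS.clamp_mem_Icc hθ t) l j

end CorrectorFourier

end Literature.Analysis.FluidPDE

end
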